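import Literature.NumberTheory.Automorphic.JacquetRayExponents
import Mathlib.LinearAlgebra.Eigenspace.Triangularizable
import HarnessLib

/-!
# A quotient character of a finite-dimensional representation of an abelian group is an eigencharacter
# (Casselman 1995 Prop. 2.1.9 / §4.4: «central characters» of Jacquet modules — quotient exponents are exponents)

Topic `NumberTheory/Automorphic`; namespace `Representation`.  THEOREMS ONLY; no definition, no named fact, no instance, no notation, no
`sorry`.  Cell `hodgecm-mathlib`; the dictionary lemma between the two typings of Casselman's criterion in the tree — ★
`UnitaryGroup.U3SquareIntegrableExponents` (#109: EIGEN-exponents of the normalised Jacquet module, ★ `Representation.HasJacquetExponent`) and ★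
`Rogawski1990.u3_squareIntegrable_jacquetExponent_decay` (#110: one-dimensional QUOTIENTS of the unnormalised Jacquet module) — generic in the
group, unconditional.  HC_CM is proved only modulo the printed citations until rung 0 closes.

## What is formalised
* §1 Linear algebra over `ℂ`: for an endomorphism `g` of `W` and a linear form `f` with `f ∘ g = c·f`: `f ∘ (g − μ)ᵏ = (c − μ)ᵏ f`
  (`apply_pow_sub_smul_one_apply`), so `f` kills every generalised eigenspace of `g` of eigenvalue `μ ≠ c`
  (`apply_eq_zero_of_mem_maxGenEigenspace`), hence — `W` finite-dimensional, the generalised eigenspaces spanning `W`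
  (`Module.End.iSup_maxGenEigenspace_eq_top`) — a NON-ZERO such `f` does not vanish on the generalised `c`-eigenspace
  (`exists_mem_maxGenEigenspace_apply_ne_zero`).
* §2 **`exists_eigenvector_of_quotient_character`** — `M` a group with `ab = ba`, `τ` a representation of `M` on a finite-dimensional complex
  space `W`, `χ : M →* ℂˣ`, `f : W →ₗ ℂ` NON-ZERO with `f(τ(m) w) = χ(m) f(w)` (a non-zero `M`-map `W → ℂ_χ`, i.e. `χ` is a QUOTIENT character of
  `τ`): then `χ` is an EIGEN-character — some `w ≠ 0` has `τ(m) w = χ(m) w` for all `m`.  Proof: among the `τ`-invariant subspaces on which `f`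
  does not vanish take one, `E₀`, of minimal dimension; by §1 applied to `τ(m)|_{E₀}`, `E₀ ∩ W_{χ(m)}(τ m)` is again such a subspace, so by minimality
  `E₀ ⊆ W_{χ(m)}(τ m)` for every `m` (all `τ(m) − χ(m)` are nilpotent on `E₀`); a common eigenvector `w ∈ E₀` of the abelian `M` (★
  `exists_character_of_forall_mem_of_comm`, eigencharacter `ψ`) then has `(ψ(m) − χ(m))ᵏ w = 0`, so `ψ = χ`.
* §3 **`hasJacquetExponent_of_quotient_character`** — for a parabolic triple `t` with ABELIAN Levi `M` and a representation `ρ` whose Jacquet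
  module `ρ_N` (★ `Representation.jacquetModule`) is finite-dimensional: a non-zero `M`-intertwining map `ρ_N → ℂ_χ` (Mathlib
  `Representation.IntertwiningMap` into `(trivial ℂ M ℂ).twist χ`) yields the NORMALISED exponent `χ · δ_P^{-1∕2}`:
  `ρ.HasJacquetExponent t (χ * (rootDeltaChar t.P ∘ incl)⁻¹)` (★ `normalizedJacquet_apply`).
-/

set_option autoImplicit false

noncomputable section

open Module

namespace Representation

open Literature.NumberTheory.Automorphic

/-! ## §1 A linear form that is an eigenvector of the transpose kills the other generalised eigenspaces -/

section LinearAlgebra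

variable {W : Type*} [AddCommGroup W] [Module ℂ W]

/-- `f ∘ (g − μ)ᵏ = (c − μ)ᵏ · f` for a linear form `f` with `f ∘ g = c · f`. [cite: Casselman1995, Prop. 2.1.9] -/
theorem apply_pow_sub_smul_one_apply (g : Module.End ℂ W) (f : W →ₗ[ℂ] ℂ) {c : ℂ} (hf : ∀ w, f (g w) = c * f w)
    (μ : ℂ) (k : ℕ) (w : W) :
    f (((g - μ • (1 : Module.End ℂ W)) ^ k) w) = (c - μ) ^ k * f w := by
  induction k generalizing w with
  | zero => rw [pow_zero, pow_zero, Module.End.one_apply, one_mul]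
  | succ k ih =>
    rw [pow_succ, Module.End.mul_apply, ih, LinearMap.sub_apply, LinearMap.smul_apply, Module.End.one_apply, map_sub,
      map_smul, hf, smul_eq_mul, pow_succ]
    ring

/-- A linear form `f` with `f ∘ g = c · f` vanishes on the generalised `μ`-eigenspace of `g` for every `μ ≠ c`.
[cite: Casselman1995, Prop. 2.1.9] -/
theorem apply_eq_zero_of_mem_maxGenEigenspace (g : Module.End ℂ W) (f : W →ₗ[ℂ] ℂ) {c : ℂ} (hf : ∀ w, f (g w) = c * f w)
    {μ : ℂ} (hμ : μ ≠ c) {w : W} (hw : w ∈ g.maxGenEigenspace μ) : f w = 0 := by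
  obtain ⟨k, hk⟩ := (Module.End.mem_maxGenEigenspace g μ w).1 hw
  have h := apply_pow_sub_smul_one_apply g f hf μ k w
  rw [hk, map_zero] at h
  exact (mul_eq_zero.1 h.symm).resolve_left (pow_ne_zero _ (sub_ne_zero.2 (Ne.symm hμ)))

/-- In finite dimension, a NON-ZERO linear form `f` with `f ∘ g = c · f` does not vanish on the generalised `c`-eigenspace of `g` (the
generalised eigenspaces span, `Module.End.iSup_maxGenEigenspace_eq_top`, and `f` kills those of eigenvalue `≠ c`).
[cite: Casselman1995, Prop. 2.1.9] -/
theorem exists_mem_maxGenEigenspace_apply_ne_zero [FiniteDimensional ℂ W] (g : Module.End ℂ W) (f : W →ₗ[ℂ] ℂ) {c : ℂ}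
    (hf : ∀ w, f (g w) = c * f w) (h0 : ∃ w, f w ≠ 0) :
    ∃ w ∈ g.maxGenEigenspace c, f w ≠ 0 := by
  by_contra hcon
  push Not at hcon
  obtain ⟨w₀, hw₀⟩ := h0
  apply hw₀
  have hall : ∀ μ, ∀ w ∈ g.maxGenEigenspace μ, f w = 0 := by
    intro μ w hw
    by_cases hμ : μ = c
    · subst hμ
      exact hcon w hw
    · exact apply_eq_zero_of_mem_maxGenEigenspace g f hf hμ hw
  have htop : w₀ ∈ ⨆ μ, g.maxGenEigenspace μ := by
    rw [Module.End.iSup_maxGenEigenspace_eq_top]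
    exact Submodule.mem_top
  exact Submodule.iSup_induction (fun μ => g.maxGenEigenspace μ) (motive := fun w => f w = 0) htop
    (fun μ w hw => hall μ w hw) (map_zero f) (fun x y hx hy => by rw [map_add, hx, hy, add_zero])

end LinearAlgebra

/-! ## §2 Quotient characters of abelian groups are eigencharacters -/

section QuotientCharacter

variable {M W : Type*} [Group M] [AddCommGroup W] [Module ℂ W]

/-- **A quotient character of a finite-dimensional representation of an abelian group is an eigencharacter**: if `M` is a group with
`ab = ba`, `τ` a representation of `M` on a finite-dimensional complex `W`, `χ : M →* ℂˣ` and `f : W →ₗ ℂ` a NON-ZERO linear form with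
`f (τ m w) = χ m · f w` (a non-zero `M`-map `W → ℂ_χ`), then some `w ≠ 0` satisfies `τ m w = χ m • w` for every `m`.
[cite: Casselman1995, Prop. 2.1.9 and §4.4 p. 45] [cite: BernsteinZelevinsky1977, §2.3] -/
theorem exists_eigenvector_of_quotient_character [FiniteDimensional ℂ W] (τ : Representation ℂ M W)
    (hM : ∀ a b : M, a * b = b * a) (χ : M →* ℂˣ) (f : W →ₗ[ℂ] ℂ) (hf : f ≠ 0)
    (hfχ : ∀ (m : M) (w : W), f (τ m w) = ((χ m : ℂˣ) : ℂ) * f w) :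
    ∃ w : W, w ≠ 0 ∧ ∀ m : M, τ m w = ((χ m : ℂˣ) : ℂ) • w := by
  classical
  have hcomm : ∀ m m' : M, Commute (τ m) (τ m') := fun m m' => by
    show τ m * τ m' = τ m' * τ m
    rw [← map_mul, hM, map_mul]
  have h0 : ∃ w, f w ≠ 0 := by
    by_contra h
    push Not at h
    exact hf (LinearMap.ext h)
  -- invariant subspaces on which `f` does not vanish, by dimension
  let P : ℕ → Prop := fun d => ∃ E : Submodule ℂ W,
    (∀ m : M, ∀ w ∈ E, τ m w ∈ E) ∧ (∃ w ∈ E, f w ≠ 0) ∧ Module.finrank ℂ E = d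
  have hP : ∃ d, P d := by
    obtain ⟨w, hw⟩ := h0
    exact ⟨_, ⊤, fun _ _ _ => Submodule.mem_top, ⟨w, Submodule.mem_top, hw⟩, rfl⟩
  obtain ⟨E₀, hinv, hgood, hd⟩ := Nat.find_spec hP
  have hmin : ∀ E : Submodule ℂ W, (∀ m : M, ∀ w ∈ E, τ m w ∈ E) → (∃ w ∈ E, f w ≠ 0) →
      Module.finrank ℂ E₀ ≤ Module.finrank ℂ E := by
    intro E h1 h2
    rw [hd]
    exact Nat.find_min' hP ⟨E, h1, h2, rfl⟩
  -- every `τ m − χ m` is nilpotent on `E₀`: `E₀ ≤ W_{χ m}(τ m)`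
  have hnil : ∀ m : M, E₀ ≤ Module.End.maxGenEigenspace (τ m : Module.End ℂ W) ((χ m : ℂˣ) : ℂ) := by
    intro m
    let E₁ : Submodule ℂ W := E₀ ⊓ Module.End.maxGenEigenspace (τ m : Module.End ℂ W) ((χ m : ℂˣ) : ℂ)
    have h1inv : ∀ m' : M, ∀ w ∈ E₁, τ m' w ∈ E₁ := fun m' w hw =>
      ⟨hinv m' w hw.1, Module.End.mapsTo_maxGenEigenspace_of_comm (hcomm m m') _ hw.2⟩
    have h1good : ∃ w ∈ E₁, f w ≠ 0 := by
      obtain ⟨x₀, hx₀E, hx₀⟩ := hgood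
      -- restrict `τ m` and `f` to `E₀`
      let g₀ : Module.End ℂ E₀ := (τ m).restrict (hinv m)
      let f₀ : E₀ →ₗ[ℂ] ℂ := f ∘ₗ E₀.subtype
      have hf₀ : ∀ w : E₀, f₀ (g₀ w) = ((χ m : ℂˣ) : ℂ) * f₀ w := fun w => hfχ m w
      obtain ⟨y, hy, hy0⟩ := exists_mem_maxGenEigenspace_apply_ne_zero g₀ f₀ hf₀ ⟨⟨x₀, hx₀E⟩, hx₀⟩
      refine ⟨(y : W), ⟨y.2, ?_⟩, hy0⟩
      have hres := Module.End.genEigenspace_restrict (τ m) E₀ ⊤ ((χ m : ℂˣ) : ℂ) (hinv m)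
      have hy' : y ∈ Module.End.genEigenspace g₀ ((χ m : ℂˣ) : ℂ) ⊤ := hy
      rw [hres, Submodule.mem_comap] at hy'
      exact hy'
    have hle : E₁ ≤ E₀ := inf_le_left
    have hEq : E₁ = E₀ := Submodule.eq_of_le_of_finrank_le hle (hmin E₁ h1inv h1good)
    rw [← hEq]
    exact inf_le_right
  -- a common eigenvector of the abelian `M` inside `E₀`; its eigencharacter is `χ`
  have hne : E₀ ≠ ⊥ := by
    obtain ⟨w, hwE, hw⟩ := hgood
    rw [Submodule.ne_bot_iff]
    exact ⟨w, hwE, fun h => hw (by rw [h, map_zero])⟩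
  obtain ⟨ψ, w, hwE, hw0, hw⟩ := exists_character_of_forall_mem_of_comm τ hM E₀ hne hinv
  refine ⟨w, hw0, fun m => ?_⟩
  obtain ⟨k, hk⟩ := (Module.End.mem_maxGenEigenspace _ _ _).1 (hnil m hwE)
  have hstep : ∀ x : W, τ m x = ((ψ m : ℂˣ) : ℂ) • x →
      (τ m - ((χ m : ℂˣ) : ℂ) • (1 : Module.End ℂ W)) x = (((ψ m : ℂˣ) : ℂ) - χ m) • x := by
    intro x hx
    rw [LinearMap.sub_apply, LinearMap.smul_apply, Module.End.one_apply, hx, sub_smul]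
  have hpow : ∀ j : ℕ, ((τ m - ((χ m : ℂˣ) : ℂ) • (1 : Module.End ℂ W)) ^ j) w = ((((ψ m : ℂˣ) : ℂ) - χ m) ^ j) • w := by
    intro j
    induction j with
    | zero => rw [pow_zero, pow_zero, Module.End.one_apply, one_smul]
    | succ j ih => rw [pow_succ', Module.End.mul_apply, ih, map_smul, hstep w (hw m), smul_smul, pow_succ', mul_comm]
  rw [hpow k] at hk
  have hzero : (((ψ m : ℂˣ) : ℂ) - χ m) ^ k = 0 := (smul_eq_zero.1 hk).resolve_right hw0
  have hψχ : ((ψ m : ℂˣ) : ℂ) = χ m := sub_eq_zero.1 (pow_eq_zero_iff'.1 hzero).1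
  rw [hw m, hψχ]

end QuotientCharacter

/-! ## §3 Quotient exponents of a Jacquet module are (normalised) exponents -/

section Jacquet

variable {G V : Type*} [Group G] [TopologicalSpace G] [IsTopologicalGroup G] [AddCommGroup V] [Module ℂ V]
  {ρ : Representation ℂ G V}

/-- **A quotient character of the Jacquet module is a normalised exponent** (abelian Levi, finite-dimensional Jacquet module): a NON-ZERO
`M`-intertwining map `ρ_N → ℂ_χ` from the unnormalised Jacquet module (★ `Representation.jacquetModule`) gives
`ρ.HasJacquetExponent t (χ · δ_P^{-1∕2})` (★ `HasJacquetExponent`, eigenvector of the normalised module `r_P ρ = ρ_N ⊗ δ_P^{-1∕2}`).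
[cite: Casselman1995, §4.4 p. 45 and Prop. 2.1.9] [cite: BernsteinZelevinsky1977, §2.3] -/
theorem hasJacquetExponent_of_quotient_character (t : ParabolicTriple G) [LocallyCompactSpace ↥t.P]
    (hM : ∀ a b : ↥t.M, a * b = b * a) [FiniteDimensional ℂ (t.restrict ρ).Coinvariants] (χ : ↥t.M →* ℂˣ)
    (f : (ρ.jacquetModule t).IntertwiningMap ((Representation.trivial ℂ ↥t.M ℂ).twist χ)) (hf : f.toLinearMap ≠ 0) :
    ρ.HasJacquetExponent t (χ * ((rootDeltaChar t.P).comp (Subgroup.inclusion t.M_le))⁻¹) := by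
  have hfχ : ∀ (m : ↥t.M) (w : (t.restrict ρ).Coinvariants),
      f.toLinearMap (ρ.jacquetModule t m w) = ((χ m : ℂˣ) : ℂ) * f.toLinearMap w := by
    intro m w
    rw [IntertwiningMap.toLinearMap_apply, f.isIntertwining, Representation.twist_apply, Representation.trivial_apply,
      smul_eq_mul, IntertwiningMap.toLinearMap_apply]
  obtain ⟨w, hw0, hw⟩ := exists_eigenvector_of_quotient_character (ρ.jacquetModule t) hM χ f.toLinearMap hf hfχ
  refine ⟨w, hw0, fun m => ?_⟩
  rw [normalizedJacquet_apply, hw m, smul_smul, MonoidHom.mul_apply, MonoidHom.inv_apply, MonoidHom.comp_apply,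
    Units.val_mul, mul_comm]

end Jacquet

end Representation

end
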